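import Literature.NumberTheory.CubicFields.VoronoiChain
import HarnessLib

/-!
# Reduction theory of fractional ideals of a cubic field of signature (1,1) (Voronoi, Buchmann–Williams)

Topic `Literature/NumberTheory/CubicFields`; continues `VoronoiRelativeMinima.lean` and
`VoronoiChain.lean`. For a cubic number field `K` with a real embedding `σ₁` and a non-real embedding
`σ₂` (unit rank one) and a fractional ideal `I` of `𝓞 K`, the geometry-of-numbers input of the
Voronoi / Williams–Dueck–Schmid / Buchmann–Williams algorithms (regulator and class group of a complex
cubic field by walking the cycle of reduced ideals):

* `absNorm_le_abs_mul_norm_sq` — `N(I) ≤ |N(t)| = |σ₁ t| ‖σ₂ t‖²` for a nonzero `t ∈ I`;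
* `infinitePlace_pair` — the two infinite places `|σ₁ ·|` (multiplicity `1`), `‖σ₂ ·‖` (multiplicity
  `2`), `r₁ = r₂ = 1`;
* `exists_ne_zero_mem_abs_lt_norm_lt` — MINKOWSKI IN THE NORMED BODY: the box
  `{|σ₁| < X, ‖σ₂‖ < Y}` contains a nonzero point of `I` as soon as `X Y² > (2√|d_K|/π) N(I)`
  (Mathlib's `NumberField.mixedEmbedding.exists_ne_zero_mem_ideal_lt` in the mixed space, where the
  box has volume `2πXY²` and the lattice `I` has covolume `N(I) √|d_K| / 2`);
* `abs_mul_norm_sq_le_of_mem_relMinima` — a relative minimum `θ` of `I` has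
  `|N θ| = |σ₁ θ| ‖σ₂ θ‖² ≤ (2√|d_K|/π) N(I)`; `one_mem_posRelMinima_one` — `1` is a positive
  relative minimum of `𝓞 K`; `voronoiSucc_le_mul` — the GAP BOUND `σ₁ (succ μ) ≤ 3 √|d_K| σ₁ μ`;
* `exists_cylinder_min` — the UNIT-CYLINDER MINIMUM (the reducing element of the giant step): a
  nonzero `I` has a unique element `γ` of least `σ₁` in `{σ₁ > 0, ‖σ₂‖ < 1}`, it is a positive
  relative minimum, and `N(I) < σ₁ γ ≤ 3 N(I) √|d_K|`;
* `one_mem_posRelMinima_spanSingleton_inv_mul` — rescaling a positive minimum `θ` to `1`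
  (`1` is a positive minimum of `θ⁻¹ I`); `reducedIdeal_bounds` — a REDUCED ideal `J` (`1` a
  positive minimum) satisfies `𝓞 K ⊆ J` and `π / (2√|d_K|) ≤ N(J) ≤ 1`.

All statements carry the hypotheses `Module.finrank ℚ K = 3`, `∃ z, conj (σ₂ z) ≠ σ₂ z` (and a unit
`ε` with `1 < σ₁ ε` where the successor is involved) explicitly, as in the two previous files.
Theorem-only file. Not here: Voronoi's algorithm computing the successor, distance bounds along the
cycle (see `CubicRegulatorBound.lean` for the regulator bound).

## References

* G. Voronoi, *On a generalization of the algorithm of continued fractions* (1896).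
* B. N. Delone, D. K. Faddeev, *The theory of irrationalities of the third degree*, Transl. Math.
  Monographs 10, AMS (1964), Ch. IV.
* H. C. Williams, G. W. Dueck, B. K. Schmid, *A rapid method of evaluating the regulator and class
  number of a pure cubic field*, Math. Comp. 41 (1983), §§2–3. [WilliamsDueckSchmid1983]
* J. Buchmann, H. C. Williams, *On the infrastructure of the principal ideal class of an algebraic
  number field of unit rank one*, Math. Comp. 50 (1988), §§2–3. [BuchmannWilliams1988Infrastructure]
-/

namespace Literature.NumberTheory.CubicFields

open scoped NumberField ComplexConjugate nonZeroDivisors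
open NumberField

section Minkowski

variable {K : Type*} [Field K] [NumberField K] {σ₁ : K →+* ℝ} {σ₂ : K →+* ℂ}
  {I : FractionalIdeal (𝓞 K)⁰ K}

variable (hdeg : Module.finrank ℚ K = 3) (hσ₂ : ∃ z : K, starRingEnd ℂ (σ₂ z) ≠ σ₂ z)

include hdeg hσ₂ in
/-- **Containment bounds the norm** (signature (1,1) form): a nonzero element `t` of a nonzero
fractional ideal `I` has `N(I) ≤ |N(t)| = |σ₁ t| · ‖σ₂ t‖²` (`(t) = I · (I⁻¹ (t))` with `I⁻¹ (t)`
integral and nonzero, and `norm_eq_mul_norm_sq`). [folklore] -/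
theorem absNorm_le_abs_mul_norm_sq (σ₁ : K →+* ℝ) (hI : I ≠ 0) {t : K} (ht : t ∈ I) (ht0 : t ≠ 0) :
    ((FractionalIdeal.absNorm I : ℚ) : ℝ) ≤ |σ₁ t| * ‖σ₂ t‖ ^ 2 := by
  classical
  set J : FractionalIdeal (𝓞 K)⁰ K := FractionalIdeal.spanSingleton _ t with hJ
  have hJ0 : J ≠ 0 := by rw [hJ, Ne, FractionalIdeal.spanSingleton_eq_zero_iff]; exact ht0
  have hle1 : I⁻¹ * J ≤ 1 := by
    calc I⁻¹ * J ≤ I⁻¹ * I := by gcongr; exact FractionalIdeal.spanSingleton_le_iff_mem.mpr ht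
      _ = 1 := inv_mul_cancel₀ hI
  obtain ⟨B, hB⟩ := FractionalIdeal.le_one_iff_exists_coeIdeal.mp hle1
  have hB0 : B ≠ ⊥ := by
    rintro rfl
    rw [FractionalIdeal.coeIdeal_bot] at hB
    rcases mul_eq_zero.mp hB.symm with h' | h'
    · exact (inv_ne_zero hI) h'
    · exact hJ0 h'
  have hNB : (1 : ℚ) ≤ FractionalIdeal.absNorm (I⁻¹ * J) := by
    rw [← hB, FractionalIdeal.coeIdeal_absNorm]
    exact_mod_cast Nat.one_le_iff_ne_zero.mpr (by rwa [Ne, Ideal.absNorm_eq_zero_iff])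
  have key : FractionalIdeal.absNorm I ≤ FractionalIdeal.absNorm J := by
    conv_rhs => rw [show J = I * (I⁻¹ * J) by rw [← mul_assoc, mul_inv_cancel₀ hI, one_mul], map_mul]
    have h0 : 0 ≤ FractionalIdeal.absNorm I := FractionalIdeal.absNorm_nonneg I
    nlinarith
  rw [hJ, FractionalIdeal.absNorm_span_singleton (𝓞 K) t] at key
  have h : ((FractionalIdeal.absNorm I : ℚ) : ℝ) ≤ ((|Algebra.norm ℚ t| : ℚ) : ℝ) := by exact_mod_cast key
  rw [Rat.cast_abs, norm_eq_mul_norm_sq σ₁ σ₂ hdeg hσ₂ t, abs_mul, abs_of_nonneg (sq_nonneg ‖σ₂ t‖)] at h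
  exact h

include hdeg hσ₂ in
/-- **Signature (1,1)**: the infinite places of `K` are a pair `w₁ ≠ w₂` with `w₁ = |σ₁ ·|` of
multiplicity `1` (real) and `w₂ = ‖σ₂ ·‖` of multiplicity `2` (complex), so `r₁ = r₂ = 1` (the
Minkowski data of the mixed space). [folklore] -/
theorem infinitePlace_pair (σ₁ : K →+* ℝ) :
    ∃ w₁ w₂ : InfinitePlace K, w₁ ≠ w₂ ∧ (∀ w : InfinitePlace K, w = w₁ ∨ w = w₂) ∧
      w₁.mult = 1 ∧ w₂.mult = 2 ∧ (∀ x, w₁ x = |σ₁ x|) ∧ (∀ x, w₂ x = ‖σ₂ x‖) ∧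
      InfinitePlace.nrRealPlaces K = 1 ∧ InfinitePlace.nrComplexPlaces K = 1 := by
  classical
  set w₁ : InfinitePlace K := InfinitePlace.mk ((algebraMap ℝ ℂ).comp σ₁) with hw₁
  set w₂ : InfinitePlace K := InfinitePlace.mk σ₂ with hw₂
  have h1 : w₁.IsReal := by
    rw [hw₁, InfinitePlace.isReal_mk_iff, ComplexEmbedding.isReal_iff]; exact conjugate_ofReal_comp σ₁
  have h2 : w₂.IsComplex := by
    rw [hw₂, InfinitePlace.isComplex_mk_iff, ComplexEmbedding.isReal_iff]; exact conjugate_ne_self σ₂ hσ₂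
  have hne : w₁ ≠ w₂ := fun h => by
    rw [h] at h1; exact (InfinitePlace.not_isReal_iff_isComplex.mpr h2) h1
  have hsig : InfinitePlace.nrRealPlaces K = 1 ∧ InfinitePlace.nrComplexPlaces K = 1 := by
    have h := InfinitePlace.card_add_two_mul_card_eq_rank K
    rw [hdeg] at h
    have hc : 0 < InfinitePlace.nrComplexPlaces K := Fintype.card_pos_iff.mpr ⟨⟨w₂, h2⟩⟩
    have hr : 0 < InfinitePlace.nrRealPlaces K := Fintype.card_pos_iff.mpr ⟨⟨w₁, h1⟩⟩
    omega
  have huniv : (Finset.univ : Finset (InfinitePlace K)) = {w₁, w₂} := by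
    symm; apply Finset.eq_univ_of_card
    rw [InfinitePlace.card_eq_nrRealPlaces_add_nrComplexPlaces, hsig.1, hsig.2, Finset.card_pair hne]
  refine ⟨w₁, w₂, hne, fun w => by simpa [huniv] using Finset.mem_univ w, by rw [InfinitePlace.mult, if_pos h1],
    by rw [InfinitePlace.mult, if_neg (InfinitePlace.not_isReal_iff_isComplex.mpr h2)],
    fun x => ?_, fun x => ?_, hsig.1, hsig.2⟩
  · rw [hw₁, InfinitePlace.apply]; simp [Complex.norm_real]
  · rw [hw₂, InfinitePlace.apply]

include hdeg hσ₂ in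
/-- **Minkowski in the normed body** (signature (1,1)): if `X · Y² > (2√|d_K|/π) · N(I)` then the box
`{|σ₁| < X, ‖σ₂‖ < Y}` (of volume `2πXY²` in the mixed space, against the covolume `N(I)√|d_K|/2`
times `2³`) contains a nonzero point of the fractional ideal `I`. [folklore] -/
theorem exists_ne_zero_mem_abs_lt_norm_lt (hI : I ≠ 0) {X Y : ℝ} (hX : 0 < X) (hY : 0 < Y)
    (hXY : 2 * Real.sqrt |(discr K : ℝ)| / Real.pi * ((FractionalIdeal.absNorm I : ℚ) : ℝ) < X * Y ^ 2) :
    ∃ a ∈ I, a ≠ 0 ∧ |σ₁ a| < X ∧ ‖σ₂ a‖ < Y := by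
  classical
  obtain ⟨w₁, w₂, hne, hall, hm1, hm2, hw₁x, hw₂x, hr, hc⟩ := infinitePlace_pair hdeg hσ₂ σ₁
  have huniv : (Finset.univ : Finset (InfinitePlace K)) = {w₁, w₂} := by
    ext w; simpa using hall w
  set f : InfinitePlace K → NNReal := fun w => if w = w₁ then X.toNNReal else Y.toNNReal with hf
  have hf1 : f w₁ = X.toNNReal := by simp [hf]
  have hf2 : f w₂ = Y.toNNReal := by simp [hf, hne.symm]
  set I₁ : (FractionalIdeal (𝓞 K)⁰ K)ˣ := Units.mk0 I hI with hI₁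
  have hvol : mixedEmbedding.minkowskiBound K I₁ < MeasureTheory.volume (mixedEmbedding.convexBodyLT K f) := by
    rw [mixedEmbedding.convexBodyLT_volume, huniv, Finset.prod_pair (f := fun w : InfinitePlace K => f w ^ w.mult) hne,
      hm1, hm2, hf1, hf2, pow_one, ← ENNReal.toReal_lt_toReal (mixedEmbedding.minkowskiBound_lt_top K I₁).ne
      (ENNReal.mul_ne_top ENNReal.coe_ne_top ENNReal.coe_ne_top)]
    have hLHS : (mixedEmbedding.minkowskiBound K I₁).toReal =
        FractionalIdeal.absNorm I * ((2 : ℝ)⁻¹ * Real.sqrt |(discr K : ℝ)|) * 2 ^ 3 := by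
      simp_rw [mixedEmbedding.minkowskiBound, mixedEmbedding.volume_fundamentalDomain_fractionalIdealLatticeBasis,
        mixedEmbedding.volume_fundamentalDomain_latticeBasis, ENNReal.toReal_mul, ENNReal.toReal_pow,
        ENNReal.toReal_inv, ENNReal.coe_toReal, ENNReal.toReal_ofNat, mixedEmbedding.finrank]
      rw [ENNReal.toReal_ofReal (Rat.cast_nonneg.mpr (FractionalIdeal.absNorm_nonneg _)), hI₁, Units.val_mk0, hc,
        hdeg, Real.coe_sqrt, coe_nnnorm, Int.norm_eq_abs, pow_one]
    have hRHS : ((mixedEmbedding.convexBodyLTFactor K : ENNReal) *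
        ((X.toNNReal * Y.toNNReal ^ 2 : NNReal) : ENNReal)).toReal = 2 * Real.pi * (X * Y ^ 2) := by
      rw [ENNReal.toReal_mul, ENNReal.coe_toReal, ENNReal.coe_toReal]
      simp only [mixedEmbedding.convexBodyLTFactor, NNReal.coe_mul, NNReal.coe_pow, Real.coe_toNNReal _ hX.le,
        Real.coe_toNNReal _ hY.le, NNReal.coe_real_pi, NNReal.coe_ofNat, hr, hc, pow_one]
    rw [hLHS, hRHS]
    have hpi : 0 < Real.pi := Real.pi_pos
    rw [div_mul_eq_mul_div, div_lt_iff₀ hpi] at hXY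
    nlinarith
  obtain ⟨a, ha, ha0, hlt⟩ := mixedEmbedding.exists_ne_zero_mem_ideal_lt K I₁ hvol
  refine ⟨a, by simpa [hI₁] using ha, ha0, ?_, ?_⟩
  · have h := hlt w₁
    rw [hw₁x, hf1, Real.coe_toNNReal _ hX.le] at h; exact h
  · have h := hlt w₂
    rw [hw₂x, hf2, Real.coe_toNNReal _ hY.le] at h; exact h

include hdeg hσ₂ in
/-- **The norm of a relative minimum is small**: `|σ₁ θ| ‖σ₂ θ‖² ≤ (2√|d_K|/π) N(I)` for every
relative minimum `θ` of `I` (else Minkowski puts a nonzero point of `I` in the normed body of `θ`). [folklore] -/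
theorem abs_mul_norm_sq_le_of_mem_relMinima {θ : K} (hθ : θ ∈ relMinima σ₁ σ₂ I) :
    |σ₁ θ| * ‖σ₂ θ‖ ^ 2 ≤ 2 * Real.sqrt |(discr K : ℝ)| / Real.pi * ((FractionalIdeal.absNorm I : ℚ) : ℝ) := by
  have hθ0 : θ ≠ 0 := hθ.2.1
  have hI : I ≠ 0 := fun h => hθ0 ((FractionalIdeal.mem_zero_iff (𝓞 K)⁰).mp (h ▸ hθ.1))
  by_contra hcon
  push Not at hcon
  obtain ⟨a, ha, ha0, h1, h2⟩ := exists_ne_zero_mem_abs_lt_norm_lt hdeg hσ₂ hI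
    (abs_pos.mpr ((map_ne_zero σ₁).mpr hθ0)) (norm_pos_iff.mpr ((map_ne_zero σ₂).mpr hθ0)) hcon
  exact absurd (hθ.2.2 a ha ha0 h1) (not_le.mpr h2)

include hdeg hσ₂ in
/-- `1` is a positive relative minimum of the unit ideal `𝓞_K`: a nonzero algebraic integer `φ` has
`|N φ| = |σ₁ φ| ‖σ₂ φ‖² ≥ 1`, so not both conjugates are `< 1`. [folklore] -/
theorem one_mem_posRelMinima_one : (1 : K) ∈ posRelMinima σ₁ σ₂ (1 : FractionalIdeal (𝓞 K)⁰ K) := by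
  refine ⟨⟨(FractionalIdeal.mem_one_iff _).mpr ⟨1, map_one _⟩, one_ne_zero, fun φ hφ h0 hlt => ?_⟩,
    by rw [map_one]; exact one_pos⟩
  rw [map_one, norm_one]
  rw [map_one, abs_one] at hlt
  have hO : (1 : FractionalIdeal (𝓞 K)⁰ K) ≠ 0 := one_ne_zero
  have h := absNorm_le_abs_mul_norm_sq hdeg hσ₂ σ₁ hO hφ h0
  rw [FractionalIdeal.absNorm_one, Rat.cast_one] at h
  by_contra hcon
  push Not at hcon
  have h2 : ‖σ₂ φ‖ ^ 2 < 1 := by nlinarith [norm_nonneg (σ₂ φ)]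
  nlinarith [abs_nonneg (σ₁ φ), sq_nonneg ‖σ₂ φ‖]

variable (ε : (𝓞 K)ˣ) (hε : 1 < σ₁ (algebraMap (𝓞 K) K ε))

include hdeg hσ₂ hε in
/-- **The gap bound**: the Voronoi successor multiplies the real conjugate by at most `3√|d_K|`
(Minkowski in the box `{|σ₁| < (2√|d|/π + 1) σ₁ μ, ‖σ₂‖ < ‖σ₂ μ‖}`, then the least minimum below the
point found). [folklore] -/
theorem voronoiSucc_le_mul {μ : K} (hμ : μ ∈ posRelMinima σ₁ σ₂ I) :
    σ₁ (voronoiSucc σ₁ σ₂ I μ) ≤ 3 * Real.sqrt |(discr K : ℝ)| * σ₁ μ := by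
  have hμ0 : μ ≠ 0 := hμ.1.2.1
  have hI : I ≠ 0 := fun h => hμ0 ((FractionalIdeal.mem_zero_iff (𝓞 K)⁰).mp (h ▸ hμ.1.1))
  have hpos := hμ.2
  have hY : 0 < ‖σ₂ μ‖ := norm_pos_iff.mpr ((map_ne_zero σ₂).mpr hμ0)
  set D : ℝ := Real.sqrt |(discr K : ℝ)| with hD
  have hD1 : 1 ≤ D := by
    rw [hD, Real.one_le_sqrt]
    have h := abs_discr_gt_two (K := K) (by rw [hdeg]; norm_num)
    have : (2 : ℝ) < |(discr K : ℝ)| := by rw [← Int.cast_abs]; exact_mod_cast h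
    linarith
  have hNμ : ((FractionalIdeal.absNorm I : ℚ) : ℝ) ≤ σ₁ μ * ‖σ₂ μ‖ ^ 2 := by
    have h := absNorm_le_abs_mul_norm_sq hdeg hσ₂ σ₁ hI hμ.1.1 hμ0
    rwa [abs_of_pos hpos] at h
  have hpi := Real.pi_pos
  have hXY : 2 * Real.sqrt |(discr K : ℝ)| / Real.pi * ((FractionalIdeal.absNorm I : ℚ) : ℝ) <
      (2 * D / Real.pi + 1) * σ₁ μ * ‖σ₂ μ‖ ^ 2 := by
    rw [← hD]
    have h0 : 0 ≤ 2 * D / Real.pi := by positivity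
    have h1 := mul_le_mul_of_nonneg_left hNμ h0
    have h2 : 0 < σ₁ μ * ‖σ₂ μ‖ ^ 2 := by positivity
    nlinarith
  obtain ⟨a, haI, ha0, h1, h2⟩ := exists_ne_zero_mem_abs_lt_norm_lt hdeg hσ₂ hI (X := (2 * D / Real.pi + 1) * σ₁ μ)
    (Y := ‖σ₂ μ‖) (by positivity) hY hXY
  obtain ⟨ν, hν, hνpos, hν1, hν2⟩ := exists_mem_relMinima_pos_le hdeg hσ₂ haI ha0
  have hνlt : ‖σ₂ ν‖ < ‖σ₂ μ‖ := lt_of_le_of_lt hν2 h2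
  have hne : μ ≠ ν := fun h => by rw [h] at hνlt; exact lt_irrefl _ hνlt
  have hσlt : σ₁ μ < σ₁ ν := (relMinima_lt_iff hdeg hσ₂ hμ.1 hν hpos hνpos hne).mpr hνlt
  have hnxt := (voronoiSucc_spec hdeg hσ₂ ε hε hμ).2.2 ν ⟨hν, hνpos⟩ hσlt
  have hX : 2 * D / Real.pi + 1 ≤ 3 * D := by
    have hpi3 := Real.pi_gt_three
    rw [div_add_one (ne_of_gt hpi), div_le_iff₀ hpi]
    nlinarith
  calc σ₁ (voronoiSucc σ₁ σ₂ I μ) ≤ σ₁ ν := hnxt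
    _ ≤ |σ₁ a| := hν1
    _ ≤ (2 * D / Real.pi + 1) * σ₁ μ := h1.le
    _ ≤ 3 * D * σ₁ μ := mul_le_mul_of_nonneg_right hX hpos.le

end Minkowski

section Reduction

variable {K : Type*} [Field K] [NumberField K] {σ₁ : K →+* ℝ} {σ₂ : K →+* ℂ}
  {I : FractionalIdeal (𝓞 K)⁰ K}
variable (hdeg : Module.finrank ℚ K = 3) (hσ₂ : ∃ z : K, starRingEnd ℂ (σ₂ z) ≠ σ₂ z)

omit [NumberField K] in
/-- Fractional ideals are closed under negation. [folklore] -/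
theorem neg_mem_fractionalIdeal {x : K} (hx : x ∈ I) : -x ∈ I :=
  FractionalIdeal.mem_coe.mp (Submodule.neg_mem _ (FractionalIdeal.mem_coe.mpr hx))

include hdeg hσ₂ in
/-- **The unit-cylinder minimum** (the reducing element of the Buchmann–Williams giant step): a
nonzero fractional ideal `I` has a unique element `γ` of least real conjugate in the open cylinder
`{σ₁ > 0, ‖σ₂‖ < 1}`; it is a positive relative minimum of `I`, `N(I) ≤ |N γ| < σ₁ γ`, and
`σ₁ γ ≤ 3 N(I) √|d_K|` (Minkowski: the box `{|σ₁| < 3N(I)√|d_K|, ‖σ₂‖ < 1}` meets `I ∖ 0`). [folklore] -/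
theorem exists_cylinder_min (hI : I ≠ 0) :
    ∃ γ : K, γ ∈ I ∧ 0 < σ₁ γ ∧ ‖σ₂ γ‖ < 1 ∧
      (∀ φ : K, φ ∈ I → 0 < σ₁ φ → ‖σ₂ φ‖ < 1 → σ₁ γ ≤ σ₁ φ) ∧
      (∀ φ : K, φ ∈ I → 0 < σ₁ φ → ‖σ₂ φ‖ < 1 → σ₁ φ ≤ σ₁ γ → φ = γ) ∧
      γ ∈ posRelMinima σ₁ σ₂ I ∧
      ((FractionalIdeal.absNorm I : ℚ) : ℝ) < σ₁ γ ∧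
      σ₁ γ ≤ 3 * ((FractionalIdeal.absNorm I : ℚ) : ℝ) * Real.sqrt |(discr K : ℝ)| := by
  have hN0 : (0 : ℝ) < ((FractionalIdeal.absNorm I : ℚ) : ℝ) := by
    have h0 : FractionalIdeal.absNorm I ≠ 0 := fun h => hI (FractionalIdeal.absNorm_eq_zero_iff.mp h)
    have := lt_of_le_of_ne (FractionalIdeal.absNorm_nonneg I) (Ne.symm h0)
    exact_mod_cast this
  have hD0 : 0 < Real.sqrt |(discr K : ℝ)| := by
    rw [Real.sqrt_pos, ← Int.cast_abs]
    exact_mod_cast (abs_pos.mpr (discr_ne_zero K))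
  set N : ℝ := ((FractionalIdeal.absNorm I : ℚ) : ℝ) with hN
  set D : ℝ := Real.sqrt |(discr K : ℝ)| with hD
  -- a point of `I` in the cylinder, by Minkowski
  obtain ⟨a, ha, ha0, h1, h2⟩ := exists_ne_zero_mem_abs_lt_norm_lt hdeg hσ₂ hI (X := 3 * N * D) (Y := 1)
    (by positivity) one_pos (by
      rw [one_pow, mul_one, div_mul_eq_mul_div, div_lt_iff₀ Real.pi_pos]
      nlinarith [Real.pi_gt_three, mul_pos hN0 hD0])
  obtain ⟨b, hb, hbpos, hb1, hb2⟩ : ∃ b ∈ I, 0 < σ₁ b ∧ σ₁ b < 3 * N * D ∧ ‖σ₂ b‖ < 1 := by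
    rcases lt_or_gt_of_ne ((map_ne_zero σ₁).mpr ha0) with hneg | hpos
    · refine ⟨-a, neg_mem_fractionalIdeal ha, by rw [map_neg]; linarith, ?_, by rwa [map_neg, norm_neg]⟩
      rw [map_neg]; rw [abs_of_neg hneg] at h1; exact h1
    · exact ⟨a, ha, hpos, (le_abs_self _).trans_lt h1, h2⟩
  -- the least such point
  set F : Set K := {ψ : K | ψ ∈ I ∧ |σ₁ ψ| ≤ σ₁ b ∧ ‖σ₂ ψ‖ ≤ 1} ∩ {ψ | 0 < σ₁ ψ ∧ ‖σ₂ ψ‖ < 1} with hF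
  have hFfin : F.Finite := (finite_mem_bounded σ₁ σ₂ hdeg hσ₂ I (σ₁ b) 1).inter_of_left _
  have hbF : b ∈ F := ⟨⟨hb, by rw [abs_of_pos hbpos], hb2.le⟩, hbpos, hb2⟩
  obtain ⟨γ, hγF, hmin⟩ := Set.exists_min_image F (fun ψ => σ₁ ψ) hFfin ⟨b, hbF⟩
  obtain ⟨⟨hγI, hγb, -⟩, hγpos, hγ1⟩ := hγF
  have hleast : ∀ φ : K, φ ∈ I → 0 < σ₁ φ → ‖σ₂ φ‖ < 1 → σ₁ γ ≤ σ₁ φ := by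
    intro φ hφ hφpos hφ1
    rcases le_or_gt (σ₁ φ) (σ₁ b) with h | h
    · exact hmin φ ⟨⟨hφ, by rwa [abs_of_pos hφpos], hφ1.le⟩, hφpos, hφ1⟩
    · exact ((le_abs_self _).trans hγb).trans h.le
  have hγ0 : γ ≠ 0 := fun h => by rw [h, map_zero] at hγpos; exact lt_irrefl _ hγpos
  refine ⟨γ, hγI, hγpos, hγ1, hleast,
    fun φ hφ hφpos hφ1 hle => σ₁.injective (le_antisymm hle (hleast φ hφ hφpos hφ1)), ?_, ?_,
    (hleast b hb hbpos hb2).trans hb1.le⟩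
  · refine ⟨⟨hγI, hγ0, fun φ hφ h0 hlt => ?_⟩, hγpos⟩
    by_contra hcon
    push Not at hcon
    rw [abs_of_pos hγpos] at hlt
    rcases lt_or_gt_of_ne ((map_ne_zero σ₁).mpr h0) with hneg | hpos
    · have h := hleast (-φ) (neg_mem_fractionalIdeal hφ) (by rw [map_neg]; linarith)
        (by rw [map_neg, norm_neg]; linarith)
      rw [map_neg] at h
      rw [abs_of_neg hneg] at hlt
      linarith
    · have h := hleast φ hφ hpos (by linarith)
      rw [abs_of_pos hpos] at hlt
      linarith
  · have h := absNorm_le_abs_mul_norm_sq hdeg hσ₂ σ₁ hI hγI hγ0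
    rw [abs_of_pos hγpos] at h
    have h2 : ‖σ₂ γ‖ ^ 2 < 1 := by nlinarith [norm_nonneg (σ₂ γ)]
    calc N ≤ σ₁ γ * ‖σ₂ γ‖ ^ 2 := h
      _ < σ₁ γ * 1 := mul_lt_mul_of_pos_left h2 hγpos
      _ = σ₁ γ := mul_one _

/-- **Rescaling a minimum to `1`**: if `θ` is a positive relative minimum of `I` then `1` is a positive
relative minimum of `θ⁻¹ I`. [folklore] -/
theorem one_mem_posRelMinima_spanSingleton_inv_mul {θ : K} (hθ : θ ∈ posRelMinima σ₁ σ₂ I) :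
    (1 : K) ∈ posRelMinima σ₁ σ₂ (FractionalIdeal.spanSingleton (𝓞 K)⁰ θ⁻¹ * I) := by
  have hθ0 : θ ≠ 0 := hθ.1.2.1
  have h1θ : 0 < σ₁ θ := hθ.2
  have h2θ : 0 < ‖σ₂ θ‖ := norm_pos_iff.mpr ((map_ne_zero σ₂).mpr hθ0)
  refine ⟨⟨?_, one_ne_zero, fun φ hφ h0 hlt => ?_⟩, by rw [map_one]; exact one_pos⟩
  · rw [FractionalIdeal.mem_singleton_mul]
    exact ⟨θ, hθ.1.1, by rw [inv_mul_cancel₀ hθ0]⟩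
  · rw [FractionalIdeal.mem_singleton_mul] at hφ
    obtain ⟨ψ, hψ, rfl⟩ := hφ
    have hψ0 : ψ ≠ 0 := by rintro rfl; exact h0 (mul_zero _)
    rw [map_one, norm_one, map_mul, map_inv₀, norm_mul, norm_inv, le_inv_mul_iff₀ h2θ, mul_one]
    rw [map_one, abs_one, map_mul, map_inv₀, abs_mul, abs_inv, abs_of_pos h1θ, inv_mul_lt_iff₀ h1θ,
      mul_one] at hlt
    exact hθ.1.2.2 ψ hψ hψ0 (by rwa [abs_of_pos h1θ])

include hdeg hσ₂ in
/-- **Reduced ideals** (`1` a positive relative minimum of `J`): `J ⊇ 𝓞_K`, hence `N(J) ≤ 1`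
(`J⁻¹` is integral and nonzero), and `N(J) ≥ π / (2√|d_K|)` (the norm bound for the minimum `1`). [folklore] -/
theorem reducedIdeal_bounds {J : FractionalIdeal (𝓞 K)⁰ K} (h1 : (1 : K) ∈ posRelMinima σ₁ σ₂ J) :
    1 ≤ J ∧ ((FractionalIdeal.absNorm J : ℚ) : ℝ) ≤ 1 ∧
      Real.pi / (2 * Real.sqrt |(discr K : ℝ)|) ≤ ((FractionalIdeal.absNorm J : ℚ) : ℝ) := by
  have hJ1 : (1 : K) ∈ J := h1.1.1
  have hJ0 : J ≠ 0 := fun h => one_ne_zero ((FractionalIdeal.mem_zero_iff (𝓞 K)⁰).mp (h ▸ hJ1))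
  have hN0 : 0 < FractionalIdeal.absNorm J :=
    lt_of_le_of_ne (FractionalIdeal.absNorm_nonneg J) (Ne.symm fun h => hJ0 (FractionalIdeal.absNorm_eq_zero_iff.mp h))
  refine ⟨FractionalIdeal.one_le.mpr hJ1, ?_, ?_⟩
  · have hle : J⁻¹ ≤ 1 := by
      intro x hx
      have := (FractionalIdeal.mem_inv_iff hJ0).mp hx 1 hJ1
      rwa [mul_one] at this
    obtain ⟨B, hB⟩ := FractionalIdeal.le_one_iff_exists_coeIdeal.mp hle
    have hB0 : B ≠ ⊥ := by
      rintro rfl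
      rw [FractionalIdeal.coeIdeal_bot] at hB
      exact inv_ne_zero hJ0 hB.symm
    have hNB : (1 : ℚ) ≤ FractionalIdeal.absNorm J⁻¹ := by
      rw [← hB, FractionalIdeal.coeIdeal_absNorm]
      exact_mod_cast Nat.one_le_iff_ne_zero.mpr (by rwa [Ne, Ideal.absNorm_eq_zero_iff])
    rw [map_inv₀, one_le_inv₀ hN0] at hNB
    exact_mod_cast hNB
  · have h := abs_mul_norm_sq_le_of_mem_relMinima hdeg hσ₂ h1.1
    rw [map_one, map_one, abs_one, norm_one, one_pow, one_mul] at h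
    have hD0 : 0 < Real.sqrt |(discr K : ℝ)| := by
      rw [Real.sqrt_pos, ← Int.cast_abs]
      exact_mod_cast (abs_pos.mpr (discr_ne_zero K))
    rw [div_le_iff₀ (by positivity)]
    rw [div_mul_eq_mul_div, le_div_iff₀ Real.pi_pos] at h
    linarith

end Reduction

end Literature.NumberTheory.CubicFields
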